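import Mathlib
import HarnessLib
import Summits.Ventures.LatticeQCDFlow.Exactness.SUNResidualLayerJacobianDet
import Summits.Ventures.LatticeQCDFlow.Exactness.SUNResidualCouplingLayer

/-!
# The engine's general `SU(N)` residual coupling layer (stout-defect / plaquette-potential exponents) has the closed-form Jacobian, for every `N`

HONEST FRAMING: exact (Metropolis-corrected) sampling algorithms for lattice gauge theory;
figures of merit are autocorrelation/cost numbers at stated couplings and volumes; no
continuum-physics claim.

Venture `LatticeQCDFlow` (cell pub-lqcd), topic `Exactness`; FANOUT row 10 (`eng-equiv`: `equiv/residual.py` —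
`ResidualCoupling` with stout-defect / plaquette-potential exponents and polynomial trace weights, and its closed-form
log-det).  NEW WORK of the cell; no definition (local notations only); nothing cited as a fact.  File 10 of the series
"the residual layer's exact Jacobian IS the closed form" (`SUNJacobianTraceAlgebra` … `SUNResidualLayerJacobianDet`).

* **`hasJacobian_engineResidualCouplingLayer_det`** — under EXACTLY the hypotheses of gen-11's
  `hasJacobian_engineResidualCouplingLayer` (unitary staples `C a j y` and polynomial trace weights `acoef a j k y`
  read from the frozen links, the engine's certificate `Σ_j Σ_{k<K} (1+k)|acoef a j k y| < 1`, `C²` ambient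
  realisations `Camb`, `aamb`): (i) `0 < ∏_{a active} det TopE[1, U, a]`; (ii)
  `HasJacobian (⊗_e Haar_{SU(n)}) (Theory2.coupleFun p ψ_engine) (ofReal ∘ ∏_{a active} det TopE[1, U, a])`, where
  `TopE[1, U, a]` is the right-trivialised derivative of the engine's one-link update at the active link `a` (local
  notation = `Top` of `SUNResidualTangentOperator` for the engine exponent
  `QambE a W = Σ_j (Σ_{k<K} aamb a j k W (Re tr(W_a Camb a j W)/n)^k)(−𝒫(W_a Camb a j W))`), every `N`, `d`, `L ≥ 1`.
  A one-line specialisation of `hasJacobian_sunResidualLayer_det` (independent of gen-11 file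
  `SUNEngineResidualLayerJacobian`, whose `contDiff_engineResidualExponentAmb` is re-derived inside the proof).

Printed counterparts, NAMED ONLY: Abbott et al., arXiv:2305.02402 §4.2 (residual layers: stout, stout-defect,
plaquette-potential); Lüscher, CMP 293 (2010) 899, §3; Morningstar–Peardon, PRD 69 (2004) 054501.
-/

noncomputable section

namespace Summit.Ventures.LatticeQCDFlow.Exactness

open Literature.MathematicalPhysics.QuantumFieldTheory
open Literature.MathematicalPhysics.QuantumFieldTheory.Luscher2010
open Literature.MathematicalPhysics.QuantumFieldTheory.WilsonFlow
open MeasureTheory Filter Set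
open scoped Matrix Matrix.Norms.Frobenius Topology ContDiff ENNReal

variable {d L n : ℕ} [NeZero L] {σ : Type*} [Fintype σ]

section Engine

variable (p : Edge d L → Prop) [DecidablePred p] (K : ℕ)
  (Camb : {e : Edge d L // p e} → σ → AmbConfig d L n → Matrix (Fin n) (Fin n) ℂ)
  (aamb : {e : Edge d L // p e} → σ → ℕ → AmbConfig d L n → ℝ)

set_option quotPrecheck false in
/-- The engine's ambient residual exponent (local notation):
`QambE a W = Σ_j (Σ_{k<K} aamb a j k W · (Re tr(W_a · Camb a j W)/n)^k) · (−𝒫(W_a · Camb a j W))`. -/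
local notation "QambE" => (fun (a : {e : Edge d L // p e}) (W : AmbConfig d L n) =>
  ∑ j, ((∑ k ∈ Finset.range K, aamb a j k W * (((W a.1 * Camb a j W).trace.re / n) ^ k) : ℝ) : ℂ) •
    (-suProj (W a.1 * Camb a j W)))

set_option quotPrecheck false in
/-- The engine residual isotopy at time `τ` (local notation). -/
local notation "fambE[" τ "]" => (fun (W : AmbConfig d L n) (e : Edge d L) =>
  if h : p e then NormedSpace.exp ((τ : ℝ) • QambE ⟨e, h⟩ W) * W e else W e)

set_option quotPrecheck false in
/-- The block of the engine tangential operator (local notation; `Blk` of `SUNResidualTangentOperator` for the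
engine exponent). -/
local notation "BlkE[" τ ", " W ", " a "]" =>
  ((fderiv ℝ (fun Y : Matrix (Fin n) (Fin n) ℂ => Y * ((fambE[τ]) W a)ᴴ) 0).comp
    ((fderiv ℝ (fun W' : AmbConfig d L n => W' a) 0).comp
      ((fderiv ℝ (fambE[τ]) W).comp
        ((fderiv ℝ (fun Y : Matrix (Fin n) (Fin n) ℂ => (Pi.single a Y : AmbConfig d L n)) 0).comp
          (fderiv ℝ (fun Y : Matrix (Fin n) (Fin n) ℂ => Y * W a) 0)))))

set_option quotPrecheck false in
/-- The engine tangential operator (local notation; `Top` of `SUNResidualTangentOperator` for the engine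
exponent): `𝒫 ∘ BlkE ∘ 𝒫 + (1 − 𝒫)`. -/
local notation "TopE[" τ ", " W ", " a "]" =>
  ((fderiv ℝ (suProj (n := n)) 0).comp ((BlkE[τ, W, a]).comp (fderiv ℝ (suProj (n := n)) 0)) +
    (ContinuousLinearMap.id ℝ (Matrix (Fin n) (Fin n) ℂ) - fderiv ℝ (suProj (n := n)) 0))

/-- **The engine's general residual coupling layer has the closed-form Jacobian `∏_{a active} det TopE[1, U, a]`,
every `N`.**  Hypotheses exactly those of gen-11's `hasJacobian_engineResidualCouplingLayer`: unitary staples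
`C a j y` and polynomial trace weights `acoef a j k y` read from the frozen links, the engine's certificate
`Σ_j Σ_{k<K} (1+k)|acoef a j k y| < 1`, and `C²` ambient realisations `Camb`, `aamb`.  Conclusion: (o) continuity; (i)
`0 < ∏_{a active} det TopE[1, U, a]` everywhere; (ii)
`HasJacobian (⊗_e Haar_{SU(n)}) (Theory2.coupleFun p ψ_engine) (ofReal ∘ ∏_{a active} det TopE[1, U, a])` — the
stout-defect / plaquette-potential layers of `ResidualCoupling` book their exact log-Jacobian. -/
theorem hasJacobian_engineResidualCouplingLayer_det
    (C : {e : Edge d L // p e} → σ → ({f : Edge d L // ¬p f} → Matrix.specialUnitaryGroup (Fin n) ℂ) →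
      Matrix (Fin n) (Fin n) ℂ)
    (hCu : ∀ a j y, C a j y ∈ Matrix.unitaryGroup (Fin n) ℂ)
    (acoef : {e : Edge d L // p e} → σ → ℕ → ({f : Edge d L // ¬p f} → Matrix.specialUnitaryGroup (Fin n) ℂ) → ℝ)
    (hκ : ∀ a y, ∑ j, ∑ k ∈ Finset.range K, (1 + (k : ℝ)) * |acoef a j k y| < 1)
    (hC2 : ∀ a j, ContDiff ℝ 2 (Camb a j))
    (hCamb : ∀ a j (U : GaugeConfig d L (Matrix.specialUnitaryGroup (Fin n) ℂ)),
      Camb a j (coeConfig U) = C a j (fun f => U f))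
    (ha2 : ∀ a j k, ContDiff ℝ 2 (aamb a j k))
    (haamb : ∀ a j k (U : GaugeConfig d L (Matrix.specialUnitaryGroup (Fin n) ℂ)),
      aamb a j k (coeConfig U) = acoef a j k (fun f => U f)) :
    Continuous (fun U : GaugeConfig d L (Matrix.specialUnitaryGroup (Fin n) ℂ) =>
      ∏ a : {e : Edge d L // p e}, (TopE[(1 : ℝ), coeConfig U, a.1]).det) ∧
    (∀ U : GaugeConfig d L (Matrix.specialUnitaryGroup (Fin n) ℂ),
      0 < ∏ a : {e : Edge d L // p e}, (TopE[(1 : ℝ), coeConfig U, a.1]).det) ∧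
    HasJacobian (Measure.pi fun _ : Edge d L => haarProbability (Matrix.specialUnitaryGroup (Fin n) ℂ))
      (Theory2.coupleFun p fun a y (u : Matrix.specialUnitaryGroup (Fin n) ℂ) =>
        (⟨NormedSpace.exp (∑ j, ((∑ k ∈ Finset.range K, acoef a j k y *
              (((u : Matrix (Fin n) (Fin n) ℂ) * C a j y).trace.re / n) ^ k : ℝ) : ℂ) •
            (-suProj ((u : Matrix (Fin n) (Fin n) ℂ) * C a j y))) * u,
          residual_value_mem (fun U _ => residualExponent_skew (fun j k => acoef a j k y) K
            (fun j => C a j y) U) u.2⟩ : Matrix.specialUnitaryGroup (Fin n) ℂ))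
      (fun U => ENNReal.ofReal (∏ a : {e : Edge d L // p e}, (TopE[(1 : ℝ), coeConfig U, a.1]).det)) := by
  -- the ambient engine exponent is `C²` (as in gen-11's `contDiff_engineResidualExponentAmb`)
  have hQ2 : ∀ a : {e : Edge d L // p e}, ContDiff ℝ 2 (QambE a) := by
    intro a
    refine ContDiff.sum fun j _ => ?_
    have hloop : ContDiff ℝ 2 fun W : AmbConfig d L n => W a.1 * Camb a j W := (contDiff_eval a.1).mul (hC2 a j)
    have htr : ContDiff ℝ 2 fun W : AmbConfig d L n => ((W a.1 * Camb a j W).trace.re / n : ℝ) :=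
      ((Complex.reCLM.contDiff.comp (contDiff_trace.comp hloop)).div_const _)
    have hpoly : ContDiff ℝ 2 fun W : AmbConfig d L n =>
        ∑ k ∈ Finset.range K, aamb a j k W * (((W a.1 * Camb a j W).trace.re / n) ^ k) :=
      ContDiff.sum fun k _ => (ha2 a j k).mul (htr.pow k)
    exact (Complex.ofRealCLM.contDiff.comp hpoly).smul (contDiff_suProj.comp hloop).neg
  exact hasJacobian_sunResidualLayer_det p
    (fun a y u => ∑ j, ((∑ k ∈ Finset.range K, acoef a j k y *
        ((u * C a j y).trace.re / n) ^ k : ℝ) : ℂ) • (-suProj (u * C a j y)))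
    (fun a y => ∑ j, ∑ k ∈ Finset.range K, (1 + (k : ℝ)) * |acoef a j k y|)
    QambE
    (fun a y U _ => residualExponent_skew (fun j k => acoef a j k y) K (fun j => C a j y) U)
    (fun a y _ hU _ hV => frobNorm_residualExponent_sub_le (fun j k => acoef a j k y) K (hCu a · y)
      (Matrix.mem_specialUnitaryGroup_iff.mp hU).1 (Matrix.mem_specialUnitaryGroup_iff.mp hV).1)
    (fun a y => contractionBound_nonneg (fun j k => acoef a j k y) K) hκ hQ2
    (fun a U => by simp only [hCamb, haamb, coeConfig_apply])

end Engine

end Summit.Ventures.LatticeQCDFlow.Exactness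

end
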